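import Mathlib

/-!
# `Balaban1983to89.B11Holder9` — [Balaban1985Variational] Theorem 1 (9), the Hölder clause: the unwritten companion of
(152) and the explicit constant B₄(β₀) the paper promises (p. 279) and never writes

CITATION HEADER (lean-in-tree rule 2026-08-18).  Source: T. Bałaban, *The variational problem and background fields in
renormalization group method for lattice gauge theories*, Commun. Math. Phys. **102**, 277–309 (1985),
doi:10.1007/bf01229381 (cell paper B11; held `paper:balaban1985-cmp102-variational-background`; journal page = PDF page
+ 276; quotations read from the page renders p. 279 [PDF 3], pp. 300–305 [PDF 24–29],
`b2b-balaban-ref1/pages/1985-cmp102-variational-background/…-p003,p024…p029-x2.png`).  Reference of the paper used here: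
[6] = [Balaban1985RegularSpaces] = T. Bałaban, *Spaces of regular gauge field configurations on a lattice and gauge fixing
conditions*, Commun. Math. Phys. **99**, 75–102 (1985) (cell paper B8; Theorem 2 (1.33)–(1.39) pp. 82–83 [PDF 8–9],
Proposition 3 p. 87 [PDF 13]; sibling module `…B8`, `B8.Thm2Printed`, `B8.Prop3Constants`).  This module imports
Mathlib only and modifies nothing in `…B11`, `…B11Thm1`, `…B8`; it is real-number bookkeeping over named constants, the
mathematics being the two printed theorems it quotes.  Cell record: `HOME/b2b-balaban-b11/HOLDER-9.md` (GAPS C-B11-F3b).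

THE PRINTED TARGET (p. 279 [PDF 3], verbatim): *"for an arbitrary cube □ in the class described above, of a size 2ML^jη,
M ≤ M(ε₁), there exists a gauge transformation u defined on a neighborhood of □ and such that on □, U^{u^{−1}} = e^{iηA},
|A| < B₃Mε₁(L^jη)^{−1}, |∇^ηA| < B₃Mε₁(L^jη)^{−2}, ‖A‖_{1,β} < B₄(β₀)Mε₁(L^jη)^{−2−β} for 0 ≤ β ≤ β₀ = 1, (9)
|∂^{η*}∂^ηA|, |Δ^ηA| < B₃Mε₁(L^jη)^{−3}. (10)  The constants a₀, a₁, B₃, depend on d and L only, the constants B₄(β₀),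
M(ε₁) depend on the indicated parameters also. More exactly M(ε₁) = R₁M₁(a₁/ε₁)."* and *"In the course of the proof the
constants B₃, B₄ will be described explicitly."*  B₃ is ((162), p. 303); B₄ is described nowhere on pp. 279–309, and
Sect. F ((152), (164)–(169)) bounds the four sup quantities only (cell GAPS G-B11-F3, G-B11-F3a).

THE LOCATED DERIVATION (cell HOLDER-9.md §2; printed nowhere; the paper's by-reference standard).  p. 301 [PDF 25],
verbatim: *"Now we apply Theorem 2 of the paper [6] to the pair of configurations U′_k, 1 (in place of U′U₀, U₀ in that
paper). We assume that 9dL²Mε₀ ≤ c₁. Then there exists a unique gauge transformation u satisfying the restrictions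
ū^j = 1 on Λ′_j, and such that U′_k{}^{u^{−1}} = U₁ = e^{iηA}, L^jη|A|, (L^jη)²|∇^ηA|, (L^jη)³|∂^{η*}∂^ηA|, (L^jη)³|Δ^ηA|
< 9dL²B₁Mε₀ on Ω′_j, j = 0, 1, …, k; (152)"* — with α₀ = ε₀ and α₁ = 9dL²Mε₀ − ε₀ from (150)–(151) (*"|V″ − 1| <
9dL²Mε₀ − ε₀ on ℭ_k. (151)"*).  The conclusion (1.36) of the theorem so invoked is, verbatim ([6] p. 82 [PDF 8]):
*"U₁ = e^{iηA}, |A| < B₁(α₀ + α₁)(L^jη)^{−1}, |∇^η_{U₀}A| < B₁(α₀ + α₁)(L^jη)^{−2}, ‖A‖_{1,β} < B₂(β₀)(α₀ + α₁)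
(L^jη)^{−2−β}, β ≤ β₀ < 1, on Ω_j, j = 0, 1, …, k, (1.36)"* ([6] Theorem 2, p. 83: *"There exist constants B₁,
B₂(β₀), c₁ such that for arbitrary U₀, U′U₀ satisfying (1.33)–(1.35) with α₀ + α₁ ≤ c₁ there exists exactly one gauge
transformation u satisfying (1.29) and such that the conditions (1.36)–(1.39) hold for the configuration
U₁ = U′^{u⁻¹}."*; [6] Proposition 3, p. 87: *"… U₁ satisfies (1.36)–(1.39) with B₁ = 5dLB₀, B₂(β₀) = 5dLB₀(β₀), where
B₀, B₀(β₀) are the corresponding norms of the operators G(U₀), H(U₀), and depend on d and L only, B₀(β₀) on β₀ also."*).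
So (152) is the sup part of (1.36) ∧ (1.39) (B₁(α₀ + α₁) = 9dL²B₁Mε₀), and the Hölder part of the SAME conclusion,
dropped in (152), reads ‖A‖_{1,β} < 9dL²B₂(β₀)Mε₀(L^jη)^{−2−β}, 0 ≤ β ≤ β₀ < 1, on Ω′_j (`holder152_of_thm2`).  In the
second case of Sect. F (Δ = □ of size 2ML^jη), p. 304 [PDF 28], verbatim: *"We may take advantage of the fact that we
have proved the regularity property (8), thus we take ε₀ = B₃ε₁"*; hence ‖A‖_{1,β} < 9dL²B₂(β₀)B₃·Mε₁(L^jη)^{−2−β} on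
Ω′_j ⊇ □ — the Hölder clause of (9) with B₄(β₀) := 9dL²B₂(β₀)B₃ = 45d²L³B₀(β₀)B₃ (`B4`, `holder9_of_thm2_136`,
`B4_of_prop3`), for the same A ((159): *"A = A₁ + HB − HD(A₁ + HB)"*, the A that (169) bounds) and the same gauge.  No
new smallness: the only hypothesis, 9dL²Mε₀ ≤ c₁ with ε₀ = B₃ε₁ and M ≤ M(ε₁) = R₁M₁(a₁/ε₁), follows from
9dL²B₃R₁M₁a₁ ≤ c₁ (`smallness152_of_M_le`), a restriction of the kind p. 304 folds into a₁ (*"we define a₁ as a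
largest constant such, that the restriction ε₁ ≤ a₁ implies all the other restrictions we have imposed on ε₁"*); c₁ of
[6] does not depend on β₀, so a₁ stays β₀-free while B₄ depends on β₀ — the constants sentence of Theorem 1.

NOT DELIVERED by anything in [Balaban1985RegularSpaces] or this paper: the printed endpoint β₀ = 1 of (9) ([6] has
β ≤ β₀ < 1 only; cell GAPS C-B8-18); it is consumed by no paper of the series (cell GAPS G-B11-F3a).  Everything below is
stated for an abstract "Hölder profile" `h : ℝ → ℝ` (β ↦ ‖A‖_{1,β} on the region considered) and named real constants;
value = typed bookkeeping of a located two-line derivation, NOT summit progress.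

v1.1 (2026-08-18, unit `b2b-balaban-b11-g6`, DOCFIX answering the boundary XREAD of v1 = p177635, cell GAPS C-ref5-40):
locators only — the sentences *"We may take advantage of the fact that we have proved the regularity property (8), thus we
take ε₀ = B₃ε₁"*, *"Now we define a₁ as a largest constant such, that the restriction ε₁ ≤ a₁ implies all the other
restrictions we have imposed on ε₁"* and Proposition 8 are printed on p. 304 [PDF 28] (render `…-p028-x2.png`), not on
p. 305 as v1 wrote; (169) and *"hence we have proved the regularity conditions (9), (10), and the proof of Theorem 1 is
completed"* are on p. 305 [PDF 29] (render `…-p029-x2.png`).  Every declaration is byte-identical to v1.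

v2 (2026-08-19, unit `b2b-balaban-b11-g16`, APPEND-ONLY §2; every v1.1 declaration byte-identical): WHAT THE DERIVABLE RANGE
0 ≤ β ≤ β₀ < 1 DELIVERS TO A STENCIL CONSUMER.  Occasion (cell GAPS G-B11-G16a; record `HOME/b2b-balaban-b11-g16/HOLDER-9-STENCIL.md`):
the cell's T⁴ rung, NE3 energy route (sibling `…T4ConvexResponse` §4 `stencil_consistency`, record `HOME/t4/T4-EST-NE3-P2.md` §1/§3,
cell GAPS G-ne3p2-5) consumes (9) AT THE ENDPOINT β = β₀ = 1 — a unit-scale LIPSCHITZ bound on the minimiser's curvature F,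
"Lip_unit(F) ≤ c_d B₄(1)Mε₁" — which is the clause located above as delivered by nothing in the series (B₄(1) is undefined;
B₂(β₀) = 5dLB₀(β₀) has no bound as β₀ ↑ 1).  §2 states the consumer's two finite-sum lemmas for a β-HÖLDER F instead
(`holderStencil_consistency`: |(wF)(p) − F(p)| ≤ [F]_β ρ^β for a non-negative unit-mass stencil of width ρ;
`holderStencil_energyDefect_le`: weighted variance ≤ ([F]_β ρ^β)² · mass; β = 1 recovers the Lipschitz forms,
`holderStencil_consistency_one`) and the rate bookkeeping (`rate_pow_eq`: ((L^k)⁻¹)^β = (L^{−β})^k; `defectRate_of_holder9`: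
[F_k]_{β₀} ≤ c·B₄(β₀)Mε₁ and width ρ_k ≤ c′(L^k)⁻¹ ⇒ defect_k ≤ (c B₄(β₀) M ε₁ c′^{β₀})·(L^{−β₀})^k; `holderRate_lt_one`:
0 ≤ L^{−β₀} < 1 for L > 1, β₀ > 0).  Reading: with the DERIVABLE clause the energy route's linearised consistency defect
has the geometric rate θ_E = L^{−β₀} for every β₀ < 1 (constant B₄(β₀) = 45d²L³B₀(β₀)B₃ ↑ ∞ as β₀ ↑ 1) in place of the
L^{−1} that the underived endpoint would give, and the action-value reading L^{−2β₀} in place of L^{−2}; the cell's shape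
`…T4EtaRateMin.NE3Shape` asks only 0 ≤ θ < 1.  Nothing printed is asserted: the Hölder modulus, the stencil and the width are
displayed hypotheses; [folklore] finite sums + `Real.rpow` algebra; value = producer-side bookkeeping for a consumer of (9),
NOT summit progress (NOT infinite volume, NOT mass gap, NOT Clay).

v2.1 (2026-08-19, same unit): (a) outside XREAD (cell GAPS C-adv4-78, O1): `holderStencil_consistency_one` dropped the
hypothesis `0 ≤ dist p q`, so its hypothesis list is now LITERALLY the sibling's `stencil_consistency` (direct proof; the
rpow form with that hypothesis is kept as `holderStencil_consistency_one_eq_rpow_one`); every other declaration unchanged.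
(b) READING UPDATED (cell GAPS G-ne3p2-6, C-B11-G16b): the energy route's owner acknowledged the located objection and
RE-SOURCED its input — the route reads the curvature gradient only in L², where all mixed second differences are controlled
by the Laplacian (torus identity Σ_{μν}‖∇_μ∇_νA‖² = ‖ΔA‖², sibling `sum_normSq_comp_eq_normSq_laplacian`; interior form on
the cubes of Thm 1), with inputs the sup entries of (9) and (10) only — both DERIVED (p. 305 (169)); it keeps θ_E = L^{−1}.
Accordingly §2 is the statement for SUP-NORM consumers of a curvature modulus (a pointwise reading of the stencil defect),
for whom the derivable clause gives θ = L^{−β₀}, β₀ < 1; it is not a claim about the L²-form energy route.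
-/

namespace Literature.MathematicalPhysics.QuantumFieldTheory.Balaban1983to89.B11Holder9

/-- The Hölder clause in the SHAPE shared by [6] (1.36) and B11 (9)/(152): *"‖A‖_{1,β} < C·(L^jη)^{−2−β}"* for all
0 ≤ β ≤ β₀, with `t` = (L^jη)^{−1} and `h β` = ‖A‖_{1,β} on the region considered (Ω′_j, resp. □ ⊂ Ω′_j).
[cite: Balaban1985RegularSpaces, (1.36) p.82] [cite: Balaban1985Variational, (9) p.279] -/
def HolderClause (h : ℝ → ℝ) (β₀ C t : ℝ) : Prop :=
  ∀ β : ℝ, 0 ≤ β → β ≤ β₀ → h β < C * t ^ (2 + β)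

/-- Monotonicity of the clause in its constant (used to pass from `<` at 9dL²B₂B₃ to any larger B₄). [folklore] -/
theorem HolderClause.mono {h : ℝ → ℝ} {β₀ C C' t : ℝ} (hC : HolderClause h β₀ C t) (hle : C ≤ C') (ht : 0 < t) :
    HolderClause h β₀ C' t := by
  intro β hβ hββ₀
  have hpow : 0 < t ^ (2 + β) := Real.rpow_pos_of_pos ht _
  exact lt_of_lt_of_le (hC β hβ hββ₀) (mul_le_mul_of_nonneg_right hle hpow.le)

/-- Restriction to a sub-region (□ ⊂ Ω′_j): a Hölder seminorm over a subset is ≤ the seminorm over the set, so the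
clause passes from `h` (on Ω′_j) to any profile `h' ≤ h` (on □). [folklore] -/
theorem HolderClause.of_le {h h' : ℝ → ℝ} {β₀ C t : ℝ} (hC : HolderClause h β₀ C t)
    (hle : ∀ β, 0 ≤ β → β ≤ β₀ → h' β ≤ h β) : HolderClause h' β₀ C t :=
  fun β hβ hββ₀ => lt_of_le_of_lt (hle β hβ hββ₀) (hC β hβ hββ₀)

/-- **(152-H)**, the Hölder companion of (152): [6] Theorem 2's conclusion (1.36), *"‖A‖_{1,β} < B₂(β₀)(α₀ + α₁)
(L^jη)^{−2−β}, β ≤ β₀ < 1, on Ω_j"*, at the data of p. 301 — α₀ = ε₀, α₁ = 9dL²Mε₀ − ε₀ (from (150), (151)) —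
is ‖A‖_{1,β} < 9dL²B₂(β₀)Mε₀(L^jη)^{−2−β}.  (The sup part of the same conclusion is the printed (152) with
B₁(α₀ + α₁) = 9dL²B₁Mε₀.) [cite: Balaban1985Variational, (150)–(152) p.301] [cite: Balaban1985RegularSpaces, Thm 2 (1.36) pp.82–83] -/
theorem holder152_of_thm2 {h : ℝ → ℝ} {β₀ B₂ α₀ α₁ ε₀ d L M t : ℝ}
    (h136 : HolderClause h β₀ (B₂ * (α₀ + α₁)) t) (hα₀ : α₀ = ε₀) (hα₁ : α₁ = 9 * d * L ^ 2 * M * ε₀ - ε₀) :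
    HolderClause h β₀ (9 * d * L ^ 2 * B₂ * M * ε₀) t := by
  intro β hβ hββ₀
  have := h136 β hβ hββ₀
  have hc : B₂ * (α₀ + α₁) = 9 * d * L ^ 2 * B₂ * M * ε₀ := by rw [hα₀, hα₁]; ring
  rwa [hc] at this

/-- **B₄(β₀) := 9dL²B₂(β₀)B₃** — the explicit constant of the Hölder clause of (9) delivered by the located derivation
(the paper, p. 279: *"In the course of the proof the constants B₃, B₄ will be described explicitly"*; B₄ is not).
[cite: Balaban1985Variational, Thm 1 (9) p.279] -/
def B4 (d L B₂ B₃ : ℝ) : ℝ := 9 * d * L ^ 2 * B₂ * B₃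

/-- With [6] Proposition 3's *"B₂(β₀) = 5dLB₀(β₀)"*: B₄(β₀) = 45d²L³B₀(β₀)B₃.
[cite: Balaban1985RegularSpaces, Prop. 3 p.87] -/
theorem B4_of_prop3 (d L B₀β B₃ : ℝ) : B4 d L (5 * d * L * B₀β) B₃ = 45 * d ^ 2 * L ^ 3 * B₀β * B₃ := by
  unfold B4; ring

/-- B₄ > 0 for positive d, L, B₂, B₃ (Theorem 1 asks for *"positive constants … B₄(β₀)"*). [folklore] -/
theorem B4_pos {d L B₂ B₃ : ℝ} (hd : 0 < d) (hL : 0 < L) (hB₂ : 0 < B₂) (hB₃ : 0 < B₃) : 0 < B4 d L B₂ B₃ := by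
  unfold B4; positivity

/-- **(9-H)**: in the second case of Sect. F, p. 304 (*"we have proved the regularity property (8), thus we take
ε₀ = B₃ε₁"*), the companion (152-H) IS the Hölder clause of (9), ‖A‖_{1,β} < B₄(β₀)Mε₁(L^jη)^{−2−β} for
0 ≤ β ≤ β₀ (β₀ < 1), with `B4 d L B₂ B₃` — for the A of (152) = (159), on Ω′_j ⊇ □ (restriction to □:
`HolderClause.of_le`). [cite: Balaban1985Variational, (152) p.301 + «ε₀ = B₃ε₁» p.304 + (169) p.305 + (9) p.279] [cite: Balaban1985RegularSpaces, Thm 2 (1.36) p.82] -/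
theorem holder9_of_thm2_136 {h : ℝ → ℝ} {β₀ B₂ B₃ α₀ α₁ ε₀ ε₁ d L M t : ℝ}
    (h136 : HolderClause h β₀ (B₂ * (α₀ + α₁)) t) (hα₀ : α₀ = ε₀) (hα₁ : α₁ = 9 * d * L ^ 2 * M * ε₀ - ε₀)
    (hε₀ : ε₀ = B₃ * ε₁) :
    HolderClause h β₀ (B4 d L B₂ B₃ * M * ε₁) t := by
  intro β hβ hββ₀
  have := holder152_of_thm2 h136 hα₀ hα₁ β hβ hββ₀
  have hc : 9 * d * L ^ 2 * B₂ * M * ε₀ = B4 d L B₂ B₃ * M * ε₁ := by rw [hε₀]; unfold B4; ring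
  rwa [hc] at this

/-- **No new smallness.**  The one hypothesis of the derivation, [6] Theorem 2's *"α₀ + α₁ ≤ c₁"* = p. 301's *"We assume
that 9dL²Mε₀ ≤ c₁"*, at ε₀ = B₃ε₁ and for every cube of Theorem 1 (M ≤ M(ε₁) = R₁M₁(a₁/ε₁)), follows from the single
restriction 9dL²B₃·R₁M₁·a₁ ≤ c₁ on a₁ — of the kind p. 304 folds into a₁ (*"a₁ as a largest constant such, that the
restriction ε₁ ≤ a₁ implies all the other restrictions we have imposed on ε₁"*); it carries no β₀.
[cite: Balaban1985Variational, p.301 + p.304] [cite: Balaban1985RegularSpaces, Thm 2 p.83] -/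
theorem smallness152_of_M_le {d L B₃ R₁M₁ a₁ c₁ ε₁ M : ℝ} (hd : 0 ≤ d) (hB₃ : 0 ≤ B₃) (hε₁ : 0 < ε₁)
    (hM : M ≤ R₁M₁ * (a₁ / ε₁)) (ha₁ : 9 * d * L ^ 2 * B₃ * R₁M₁ * a₁ ≤ c₁) :
    9 * d * L ^ 2 * M * (B₃ * ε₁) ≤ c₁ := by
  have hMε : M * ε₁ ≤ R₁M₁ * a₁ := by
    have := mul_le_mul_of_nonneg_right hM hε₁.le
    calc M * ε₁ ≤ R₁M₁ * (a₁ / ε₁) * ε₁ := this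
      _ = R₁M₁ * a₁ := by field_simp
  have hK : 0 ≤ 9 * d * L ^ 2 * B₃ := by positivity
  calc 9 * d * L ^ 2 * M * (B₃ * ε₁) = 9 * d * L ^ 2 * B₃ * (M * ε₁) := by ring
    _ ≤ 9 * d * L ^ 2 * B₃ * (R₁M₁ * a₁) := mul_le_mul_of_nonneg_left hMε hK
    _ = 9 * d * L ^ 2 * B₃ * R₁M₁ * a₁ := by ring
    _ ≤ c₁ := ha₁

/-- **The whole located step in one statement** (Theorem 1 (9), Hölder clause, 0 ≤ β ≤ β₀ < 1): GIVEN [6] Theorem 2 in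
the shape "α₀ + α₁ ≤ c₁ ⇒ (1.36)-Hölder for the Landau-gauge A of the pair (U′_k, 1)" at the data (150)–(151) of
p. 301, the space-(8) value ε₀ = B₃ε₁ (Prop. 8, p. 304), a cube with M ≤ R₁M₁(a₁/ε₁) = M(ε₁), and the a₁-restriction
9dL²B₃R₁M₁a₁ ≤ c₁, the profile satisfies (9)'s clause with B₄ = 9dL²B₂B₃ on Ω′_j, hence (by `HolderClause.of_le`) on
□.  Hypothesis `thm2H` is the printed theorem read at these data; nothing else is assumed.
[cite: Balaban1985Variational, Thm 1 (9) p.279 + Sect. F pp.300–305] [cite: Balaban1985RegularSpaces, Thm 2 (1.33)–(1.36) pp.82–83] -/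
theorem holder9_located {h : ℝ → ℝ} {β₀ B₂ B₃ c₁ ε₁ d L M R₁M₁ a₁ t : ℝ}
    (thm2H : ∀ α₀ α₁ : ℝ, α₀ + α₁ ≤ c₁ → α₀ = B₃ * ε₁ → α₁ = 9 * d * L ^ 2 * M * (B₃ * ε₁) - B₃ * ε₁ →
      HolderClause h β₀ (B₂ * (α₀ + α₁)) t)
    (hd : 0 ≤ d) (hB₃ : 0 ≤ B₃) (hε₁ : 0 < ε₁) (hM : M ≤ R₁M₁ * (a₁ / ε₁))
    (ha₁ : 9 * d * L ^ 2 * B₃ * R₁M₁ * a₁ ≤ c₁) :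
    HolderClause h β₀ (B4 d L B₂ B₃ * M * ε₁) t := by
  have hsmall := smallness152_of_M_le hd hB₃ hε₁ hM ha₁
  have hsum : B₃ * ε₁ + (9 * d * L ^ 2 * M * (B₃ * ε₁) - B₃ * ε₁) ≤ c₁ := by
    have : B₃ * ε₁ + (9 * d * L ^ 2 * M * (B₃ * ε₁) - B₃ * ε₁) = 9 * d * L ^ 2 * M * (B₃ * ε₁) := by ring
    rw [this]; exact hsmall
  exact holder9_of_thm2_136 (thm2H _ _ hsum rfl rfl) rfl rfl rfl

/-! ## §2 (v2) What the derivable range 0 ≤ β ≤ β₀ < 1 delivers to a stencil consumer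

Finite index type `P` (plaquettes / sites of one region), a stencil `w p q` (intended: S*S of the cell's T⁴ NE3 energy
route, one block-averaging step — `…T4ConvexResponse.stencil_consistency`), a "distance" `dist p q ≥ 0` (physical
unit-length distance), and a field `F : P → ℝ` (intended: one component of the fine minimiser's curvature at the unit
scale).  The β-Hölder hypothesis `|F q − F p| ≤ H · dist p q ^ β` is what Theorem 1 (9) gives for 0 ≤ β ≤ β₀ < 1 with
H = c(d)·B₄(β₀)Mε₁ (`holder9_located`, `B4`); β = 1 (Lipschitz) is the underived endpoint. -/

/-- HÖLDER STENCIL CONSISTENCY: a non-negative unit-mass stencil `w p ·` supported within distance `ρ` of `p` reproduces a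
β-Hölder function up to `H · ρ^β` pointwise (`H` = the Hölder modulus, `0 ≤ β`).  The β = 1 case is the Lipschitz
consistency `…T4ConvexResponse.stencil_consistency` (`holderStencil_consistency_one`). [folklore] -/
theorem holderStencil_consistency {P : Type*} [Fintype P] (w dist : P → P → ℝ) (F : P → ℝ) {ρ H β : ℝ}
    (hw0 : ∀ p q, 0 ≤ w p q) (hw1 : ∀ p, ∑ q, w p q = 1) (hloc : ∀ p q, w p q ≠ 0 → dist p q ≤ ρ)
    (hd : ∀ p q, 0 ≤ dist p q) (hβ : 0 ≤ β) (hF : ∀ p q, |F q - F p| ≤ H * dist p q ^ β) (hH : 0 ≤ H)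
    (p : P) : |∑ q, w p q * F q - F p| ≤ H * ρ ^ β := by
  have h1 : ∑ q, w p q * F q - F p = ∑ q, w p q * (F q - F p) := by
    simp only [mul_sub, Finset.sum_sub_distrib, ← Finset.sum_mul, hw1, one_mul]
  rw [h1]
  have hterm : ∀ q, |w p q * (F q - F p)| ≤ w p q * (H * ρ ^ β) := by
    intro q
    rw [abs_mul, abs_of_nonneg (hw0 p q)]
    by_cases h : w p q = 0
    · simp [h]
    · refine mul_le_mul_of_nonneg_left ((hF p q).trans ?_) (hw0 p q)
      exact mul_le_mul_of_nonneg_left (Real.rpow_le_rpow (hd p q) (hloc p q h) hβ) hH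
  calc |∑ q, w p q * (F q - F p)| ≤ ∑ q, |w p q * (F q - F p)| := Finset.abs_sum_le_sum_abs _ _
    _ ≤ ∑ q, w p q * (H * ρ ^ β) := Finset.sum_le_sum fun q _ => hterm q
    _ = H * ρ ^ β := by rw [← Finset.sum_mul, hw1, one_mul]

/-- The β = 1 (Lipschitz) endpoint: the consistency bound `H · ρ` — the form the energy-route module
`…T4ConvexResponse.stencil_consistency` states for the (underived) endpoint β₀ = 1 of (9), with LITERALLY its
hypothesis list (v2.1, outside XREAD C-adv4-78 O1: v2 carried an extra `0 ≤ dist p q`, which the endpoint does not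
need — only the Hölder range β < 1 needs it, for the monotonicity of `rpow`). Proved directly. [folklore] -/
theorem holderStencil_consistency_one {P : Type*} [Fintype P] (w dist : P → P → ℝ) (F : P → ℝ) {ρ H : ℝ}
    (hw0 : ∀ p q, 0 ≤ w p q) (hw1 : ∀ p, ∑ q, w p q = 1) (hloc : ∀ p q, w p q ≠ 0 → dist p q ≤ ρ)
    (hF : ∀ p q, |F q - F p| ≤ H * dist p q) (hH : 0 ≤ H) (p : P) :
    |∑ q, w p q * F q - F p| ≤ H * ρ := by
  have h1 : ∑ q, w p q * F q - F p = ∑ q, w p q * (F q - F p) := by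
    simp only [mul_sub, Finset.sum_sub_distrib, ← Finset.sum_mul, hw1, one_mul]
  rw [h1]
  have hterm : ∀ q, |w p q * (F q - F p)| ≤ w p q * (H * ρ) := by
    intro q
    rw [abs_mul, abs_of_nonneg (hw0 p q)]
    by_cases h : w p q = 0
    · simp [h]
    · exact mul_le_mul_of_nonneg_left ((hF p q).trans (mul_le_mul_of_nonneg_left (hloc p q h) hH)) (hw0 p q)
  calc |∑ q, w p q * (F q - F p)| ≤ ∑ q, |w p q * (F q - F p)| := Finset.abs_sum_le_sum_abs _ _
    _ ≤ ∑ q, w p q * (H * ρ) := Finset.sum_le_sum fun q _ => hterm q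
    _ = H * ρ := by rw [← Finset.sum_mul, hw1, one_mul]

/-- With non-negative distances the endpoint lemma IS the β = 1 instance of `holderStencil_consistency`
(consistency check of the two statements). [folklore] -/
theorem holderStencil_consistency_one_eq_rpow_one {P : Type*} [Fintype P] (w dist : P → P → ℝ) (F : P → ℝ)
    {ρ H : ℝ} (hw0 : ∀ p q, 0 ≤ w p q) (hw1 : ∀ p, ∑ q, w p q = 1) (hloc : ∀ p q, w p q ≠ 0 → dist p q ≤ ρ)
    (hd : ∀ p q, 0 ≤ dist p q) (hF : ∀ p q, |F q - F p| ≤ H * dist p q ^ (1 : ℝ)) (hH : 0 ≤ H) (p : P) :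
    |∑ q, w p q * F q - F p| ≤ H * ρ ^ (1 : ℝ) :=
  holderStencil_consistency w dist F hw0 hw1 hloc hd zero_le_one hF hH p

/-- HÖLDER ENERGY-DEFECT BOUND: the `m·w`-weighted variance of a β-Hölder `F` over a stencil of width `ρ` is at most
`(H ρ^β)² · (total mass)`; with `…T4ConvexResponse.stencil_energyDefect_eq` (reversible unit-mass stencil) the energy
defect is ≤ ½ (H ρ^β)² Σ m — the action-VALUE reading at rate ρ^{2β} (L^{−2β₀} per step) in place of the ρ² of the
Lipschitz endpoint. [folklore] -/
theorem holderStencil_energyDefect_le {P : Type*} [Fintype P] (m : P → ℝ) (w dist : P → P → ℝ) (F : P → ℝ)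
    {ρ H β : ℝ} (hm : ∀ p, 0 ≤ m p) (hw0 : ∀ p q, 0 ≤ w p q) (hw1 : ∀ p, ∑ q, w p q = 1)
    (hloc : ∀ p q, w p q ≠ 0 → dist p q ≤ ρ) (hd : ∀ p q, 0 ≤ dist p q) (hβ : 0 ≤ β)
    (hF : ∀ p q, |F q - F p| ≤ H * dist p q ^ β) (hH : 0 ≤ H) (hρ : 0 ≤ ρ) :
    (1 / 2) * ∑ p, ∑ q, m p * w p q * (F p - F q) ^ 2 ≤ (1 / 2) * (H * ρ ^ β) ^ 2 * ∑ p, m p := by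
  have hb0 : 0 ≤ H * ρ ^ β := mul_nonneg hH (Real.rpow_nonneg hρ β)
  have hterm : ∀ p q, m p * w p q * (F p - F q) ^ 2 ≤ m p * w p q * (H * ρ ^ β) ^ 2 := by
    intro p q
    by_cases h : w p q = 0
    · simp [h]
    · refine mul_le_mul_of_nonneg_left ?_ (mul_nonneg (hm p) (hw0 p q))
      have hb : |F p - F q| ≤ H * ρ ^ β := by
        rw [abs_sub_comm]
        exact (hF p q).trans (mul_le_mul_of_nonneg_left (Real.rpow_le_rpow (hd p q) (hloc p q h) hβ) hH)
      calc (F p - F q) ^ 2 = |F p - F q| ^ 2 := (sq_abs _).symm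
        _ ≤ (H * ρ ^ β) ^ 2 := pow_le_pow_left₀ (abs_nonneg _) hb 2
  have hsum : ∑ p, ∑ q, m p * w p q * (F p - F q) ^ 2 ≤ ∑ p, m p * (H * ρ ^ β) ^ 2 := by
    refine Finset.sum_le_sum (fun p _ => ?_)
    calc ∑ q, m p * w p q * (F p - F q) ^ 2 ≤ ∑ q, m p * w p q * (H * ρ ^ β) ^ 2 :=
          Finset.sum_le_sum (fun q _ => hterm p q)
      _ = m p * (H * ρ ^ β) ^ 2 := by rw [← Finset.sum_mul, ← Finset.mul_sum, hw1, mul_one]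
  calc (1 / 2) * ∑ p, ∑ q, m p * w p q * (F p - F q) ^ 2 ≤ (1 / 2) * ∑ p, m p * (H * ρ ^ β) ^ 2 :=
        mul_le_mul_of_nonneg_left hsum (by norm_num)
    _ = (1 / 2) * (H * ρ ^ β) ^ 2 * ∑ p, m p := by rw [← Finset.sum_mul]; ring

/-- RATE ALGEBRA: a width `(L^k)⁻¹` (the step-k lattice spacing η_k = L^{−k} in unit lengths) raised to the Hölder exponent
β is the k-th power of the per-step rate `L^{−β}`. [folklore] -/
theorem rate_pow_eq {L : ℝ} (hL : 0 < L) (β : ℝ) (k : ℕ) : ((L ^ k)⁻¹) ^ β = (L ^ (-β)) ^ k := by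
  have hLk : 0 ≤ L ^ k := pow_nonneg hL.le k
  rw [Real.inv_rpow hLk, ← Real.rpow_natCast L k, ← Real.rpow_mul hL.le, ← Real.rpow_natCast (L ^ (-β)) k,
    ← Real.rpow_mul hL.le, ← Real.rpow_neg hL.le]
  congr 1
  ring

/-- The per-step rate of the derivable clause is honest: `0 ≤ L^{−β₀} < 1` for L > 1 and β₀ > 0 (what the cell's
`…T4EtaRateMin.NE3Shape` asks of a rate: `0 ≤ θ`, `θ < 1`). [folklore] -/
theorem holderRate_lt_one {L β₀ : ℝ} (hL : 1 < L) (hβ : 0 < β₀) : 0 ≤ L ^ (-β₀) ∧ L ^ (-β₀) < 1 :=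
  ⟨Real.rpow_nonneg (zero_le_one.trans hL.le) _, Real.rpow_lt_one_of_one_lt_of_neg hL (neg_neg_of_pos hβ)⟩

/-- **THE RATE THE DERIVABLE CLAUSE GIVES** (producer-side bookkeeping for the energy route's linearised layer).  If at
every step k the Hölder modulus of the fine minimiser's unit-scale curvature obeys `H k ≤ c · B4c · M · ε₁` — the Hölder
clause of (9) for 0 ≤ β₀ < 1 with `B4c` = `B4 d L (B₂ β₀) B₃` = 9dL²B₂(β₀)B₃ (`holder9_located`, `B4_of_prop3`), `c` the
[folklore] conversion of ‖A‖_{1,β₀} into the plaquette-field quotient — the stencil width obeys `ρ k ≤ c′ · (L^k)⁻¹`, and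
the consistency defect obeys `δ k ≤ H k · (ρ k)^β₀` (`holderStencil_consistency`), then
`δ k ≤ (c B4c M ε₁ c′^β₀) · (L^{−β₀})^k`: a GEOMETRIC rate L^{−β₀} (`holderRate_lt_one`) for every admissible β₀ < 1, with
a constant that blows up as β₀ ↑ 1 through B₂(β₀) = 5dLB₀(β₀); the endpoint rate L^{−1} would need the underived β₀ = 1.
[cite: Balaban1985Variational, Thm 1 (9) p.279 (the clause; its β₀ < 1 derivation Sect. F (152) p.301 via [6] Thm 2 (1.36))] -/
theorem defectRate_of_holder9 {L β₀ c c' B4c M ε₁ : ℝ} {H δ ρ : ℕ → ℝ} (hL : 0 < L) (hβ : 0 ≤ β₀) (hc' : 0 ≤ c')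
    (hK : 0 ≤ c * B4c * M * ε₁) (hH : ∀ k, H k ≤ c * B4c * M * ε₁) (hρ0 : ∀ k, 0 ≤ ρ k)
    (hρ : ∀ k, ρ k ≤ c' * (L ^ k)⁻¹) (hδ : ∀ k, δ k ≤ H k * ρ k ^ β₀) (k : ℕ) :
    δ k ≤ c * B4c * M * ε₁ * c' ^ β₀ * (L ^ (-β₀)) ^ k := by
  have hLk : 0 ≤ (L ^ k)⁻¹ := inv_nonneg.mpr (pow_nonneg hL.le k)
  have hρβ : ρ k ^ β₀ ≤ (c' * (L ^ k)⁻¹) ^ β₀ := Real.rpow_le_rpow (hρ0 k) (hρ k) hβ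
  have hρβ0 : 0 ≤ ρ k ^ β₀ := Real.rpow_nonneg (hρ0 k) β₀
  calc δ k ≤ H k * ρ k ^ β₀ := hδ k
    _ ≤ (c * B4c * M * ε₁) * ρ k ^ β₀ := mul_le_mul_of_nonneg_right (hH k) hρβ0
    _ ≤ (c * B4c * M * ε₁) * (c' * (L ^ k)⁻¹) ^ β₀ := mul_le_mul_of_nonneg_left hρβ hK
    _ = c * B4c * M * ε₁ * c' ^ β₀ * (L ^ (-β₀)) ^ k := by
        rw [Real.mul_rpow hc' hLk, rate_pow_eq hL β₀ k]; ring

end Literature.MathematicalPhysics.QuantumFieldTheory.Balaban1983to89.B11Holder9
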